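/-
Copyright (c) 2026. All rights reserved.
Released under Apache 2.0 license as described in the file LICENSE.
Authors: abc-iut cell, seat abc-iut-w6-d025 (block C / W6 cone prover; node `AbsTopIII:Cor4.5(v)`).
-/
import Literature.AnabelianGeometry.AbsoluteAnabelian.AbsTopIII.AutHolLogFrobeniusGaloisCenter
import HarnessLib

/-!
# [AbsTopIII] Cor 4.5 (v) at the Galois-category instance IFF `Π` is centre-free (sufficiency half)

S. Mochizuki, *Topics in Absolute Anabelian Geometry III*, Cor 4.5 (v) p. 109, Prop 4.2 (i) pp. 105–106,
§0 p. 27 (kurims manuscript, lit key `paper:url-5493eb38cbb7`; bib key `MochizukiAbsTopIII2015`);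
S. Mochizuki, *Semi-graphs of anabelioids*, §0 p. 6 ("`B(G)` is slim iff `Z_G(H) = {1}` for every open
`H`", bib key `MochizukiSemiAnbd2006`).  PROOF-ONLY companion (abc-iut cell, node `AbsTopIII:Cor4.5(v)`;
seat abc-iut-w6-d025) of `AutHolLogFrobeniusGaloisCenter.lean` (necessity half: `B(Π)` id-rigid ⟹
`Z(Π) = 1`).  No new notion is declared.

Here the SUFFICIENCY half, by the compactness argument of [SemiAnbd] §0 (there for the forgetful
functors `B(G)_A → B(G)`; abc-iut-L3's `bCat_isSlim_iff_isSlimGroup_holds`) run for the IDENTITY functor: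
`isIdRigid_bCat_of_center_eq_bot` — for a centre-free profinite `G`, `B(G)` is id-rigid.  Let `α` be an
automorphism of `𝟭_{B(G)}`; on the coset objects `G/K` (`K` open normal) write `α(eK) = n_K K`;
naturality along the projections `G/K' → G/K` makes the closed cosets `n_K K` a directed family, so by
compactness some `n` lies in all of them; naturality along right multiplication by any `x ∈ G` gives
`[n, x] ∈ K` for every `K`, whence `n ∈ Z(G) = {1}` (open normal subgroups separate points), every
`α(eK) = eK`, and — every point of a finite continuous `G`-set being the image of `eK` under an orbit
map — `α = id`.  Hence `isIdRigid_bCat_iff_center_eq_bot` and, at abc-iut-L4-t10's Galois-category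
instance of the archimedean model, **`AbsTopIII.cor_4_5_v_arch_ofGaloisCategory_iff_center_eq_bot`:
Cor 4.5 (v) holds at `EA = B(Π)` IFF `Z(Π) = 1`** (+ `TM`; `…_of_center_eq_bot`): the exact
group-theoretic content of item (v) at this instance, strictly weaker than the slimness (Lemma 4.3)
through which print routes Prop 4.2 (i).

Rider (appended): `AbsTopIII.cor_4_5_arch_ofGaloisCategory_iff_center_eq_bot` — the WHOLE typed Cor 4.5
(i)–(v) holds at `EA = B(Π)` IFF `Z(Π) = 1` (object `Π/Π`; + `TM`).

Refereed pre-IUT material; nothing here bears on [IUTchIII] Cor. 3.12 or takes a side; model-level ≠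
node-level.
-/

namespace Literature.AnabelianGeometry.AbsoluteAnabelian

open _root_.CategoryTheory
open Literature.AlgebraicGeometry.Frobenioids (BCat IsSlimGroup)
open scoped FintypeCatDiscrete Pointwise

universe u

section CenterFree

variable {G : Type u} [Group G] [TopologicalSpace G]

/-- Equivariance of a morphism of `B(G)`, pointwise. [folklore] -/
private theorem bCat_hom_smul' {X Y : BCat G} (f : X ⟶ Y) (g : G) (x : X.obj.V) :
    f.hom.hom (g • x) = g • f.hom.hom x := by
  have e := ConcreteCategory.congr_hom (f.hom.comm g) x
  simp only [FintypeCat.comp_apply] at e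
  exact e

variable [IsTopologicalGroup G]

/-- A finite `G`-set is continuous iff every stabiliser is open (Mathlib's
`continuousSMul_iff_stabilizer_isOpen`). [folklore] -/
private theorem bCat_isContinuous_iff (X : Action FintypeCat.{u} G) :
    Action.IsContinuous X ↔ ∀ x : X.V, IsOpen (MulAction.stabilizer G x : Set G) := by
  constructor
  · intro h
    have h' : ContinuousSMul G X.V := h
    exact continuousSMul_iff_stabilizer_isOpen.mp h'
  · intro h
    have h' : ContinuousSMul G X.V := continuousSMul_iff_stabilizer_isOpen.mpr h
    exact h'

/-- The finite coset `G`-set `G ⧸ K` of an open subgroup of finite index is continuous (the stabiliser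
of `gK` is `gKg⁻¹`). [folklore] -/
private theorem bCat_isContinuous_quot (K : Subgroup G) [Finite (G ⧸ K)] (hK : IsOpen (K : Set G)) :
    Action.IsContinuous (G ⧸ₐ K) := by
  rw [bCat_isContinuous_iff]
  intro q
  obtain ⟨g₀, hg₀⟩ := QuotientGroup.mk_surjective (q : G ⧸ K)
  have key : (MulAction.stabilizer G q : Set G) = (fun g : G => g₀⁻¹ * g * g₀) ⁻¹' (K : Set G) := by
    ext g
    simp only [SetLike.mem_coe, MulAction.mem_stabilizer_iff, Set.mem_preimage]
    rw [← hg₀]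
    change (g • (g₀ : G ⧸ K) : G ⧸ K) = (g₀ : G ⧸ K) ↔ _
    rw [MulAction.Quotient.smul_coe, smul_eq_mul, eq_comm, QuotientGroup.eq, mul_assoc]
  have hopen : IsOpen ((fun g : G => g₀⁻¹ * g * g₀) ⁻¹' (K : Set G)) := hK.preimage (by fun_prop)
  exact (congrArg IsOpen key).mpr hopen

variable [CompactSpace G] [TotallyDisconnectedSpace G]

/-- **A centre-free profinite group has an id-rigid `B(G)`** (centre variant of [SemiAnbd] §0 "`B(G)`
slim iff `G` slim", (⇐)).  Let `α` be an automorphism of `𝟭_{B(G)}`.  On the coset objects `G/K`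
(`K` open normal) write `α(eK) = n_K K`; naturality along the projections `G/K' → G/K` makes the closed
cosets `n_K K` a directed family, so by compactness some `n` lies in all of them; naturality along
right multiplication by ANY `x ∈ G` gives `[n, x] ∈ K` for every `K`, whence (open normal subgroups
separate points) `n ∈ Z(G) = {1}`, every `α(eK) = eK`, and — every point of every finite continuous
`G`-set being the image of `eK` under an orbit map — `α = id`.
[cite: MochizukiSemiAnbd2006, Section 0 p.6] -/
theorem isIdRigid_bCat_of_center_eq_bot (hZ : Subgroup.center G = ⊥) : IsIdRigid (BCat G) := by
  classical
  intro α
  haveI hfin : ∀ K : OpenNormalSubgroup G, Finite (G ⧸ K.toSubgroup) :=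
    fun K => Subgroup.quotient_finite_of_isOpen K.toSubgroup K.isOpen'
  -- the coset objects `G/K`
  let QV : OpenNormalSubgroup G → BCat G := fun K =>
    ⟨G ⧸ₐ K.toSubgroup, bCat_isContinuous_quot K.toSubgroup K.isOpen'⟩
  -- the action of `α` on the cosets
  let ev : ∀ K : OpenNormalSubgroup G, G ⧸ K.toSubgroup → G ⧸ K.toSubgroup :=
    fun K q => (α.hom.app (QV K)).hom.hom q
  have ev_smul : ∀ K (x : G) (q : G ⧸ K.toSubgroup), ev K (x • q) = x • ev K q :=
    fun K x q => bCat_hom_smul' (α.hom.app (QV K)) x q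
  -- naturality of `α`, pointwise
  have nat : ∀ {X Y : BCat G} (k : X ⟶ Y) (v : X.obj.V),
      (α.hom.app Y).hom.hom (k.hom.hom v) = k.hom.hom ((α.hom.app X).hom.hom v) :=
    fun {X Y} k v => by
      have h := congrArg (fun φ : (𝟭 (BCat G)).obj X ⟶ (𝟭 (BCat G)).obj Y => φ.hom.hom v)
        (α.hom.naturality k)
      exact h
  -- (1) monotonicity: naturality along the projection `G/K' → G/K`
  have mono : ∀ (K K' : OpenNormalSubgroup G) (hle : K'.toSubgroup ≤ K.toSubgroup) (n : G),
      ev K' ((1 : G) : G ⧸ K'.toSubgroup) = (n : G ⧸ K'.toSubgroup) →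
      ev K ((1 : G) : G ⧸ K.toSubgroup) = (n : G ⧸ K.toSubgroup) := by
    intro K K' hle n hn
    let p : QV K' ⟶ QV K := ObjectProperty.homMk
      { hom := FintypeCat.homMk fun q : G ⧸ K'.toSubgroup =>
          Quotient.map' id (fun g g' h => by
            have h' : g⁻¹ * g' ∈ K'.toSubgroup := QuotientGroup.leftRel_apply.mp h
            exact QuotientGroup.leftRel_apply.mpr (hle h')) q
        comm := fun x => by
          apply FintypeCat.hom_ext
          intro q
          obtain ⟨g, rfl⟩ := QuotientGroup.mk_surjective (q : G ⧸ K'.toSubgroup)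
          simp only [FintypeCat.comp_apply, FintypeCat.homMk_apply]
          change Quotient.map' id _ (x • (g : G ⧸ K'.toSubgroup)) =
            (x • (g : G ⧸ K.toSubgroup) : G ⧸ K.toSubgroup)
          rw [MulAction.Quotient.smul_coe, smul_eq_mul, MulAction.Quotient.smul_coe, smul_eq_mul]
          rfl }
    have h := nat p ((1 : G) : G ⧸ K'.toSubgroup)
    have hn₁ : (α.hom.app (QV K')).hom.hom ((1 : G) : G ⧸ K'.toSubgroup) =
        (n : G ⧸ K'.toSubgroup) := hn
    rw [hn₁] at h
    exact h
  -- (2) naturality along right multiplication by an arbitrary `x ∈ G` (`K` is normal)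
  have conj : ∀ (K : OpenNormalSubgroup G) (x : G) (n : G),
      ev K ((1 : G) : G ⧸ K.toSubgroup) = (n : G ⧸ K.toSubgroup) →
      ev K (x : G ⧸ K.toSubgroup) = ((n * x : G) : G ⧸ K.toSubgroup) := by
    intro K x n hn
    let r : QV K ⟶ QV K := ObjectProperty.homMk
      { hom := FintypeCat.homMk fun q : G ⧸ K.toSubgroup =>
          Quotient.map' (fun g : G => g * x) (fun g g' h => by
            have h' : g⁻¹ * g' ∈ K.toSubgroup := QuotientGroup.leftRel_apply.mp h
            apply QuotientGroup.leftRel_apply.mpr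
            have : (g * x)⁻¹ * (g' * x) = x⁻¹ * (g⁻¹ * g') * x := by group
            rw [this]
            exact K.isNormal'.conj_mem' _ h' x) q
        comm := fun y => by
          apply FintypeCat.hom_ext
          intro q
          obtain ⟨g, rfl⟩ := QuotientGroup.mk_surjective (q : G ⧸ K.toSubgroup)
          simp only [FintypeCat.comp_apply, FintypeCat.homMk_apply]
          change Quotient.map' _ _ (y • (g : G ⧸ K.toSubgroup)) =
            (y • ((g * x : G) : G ⧸ K.toSubgroup) : G ⧸ K.toSubgroup)
          rw [MulAction.Quotient.smul_coe, smul_eq_mul, MulAction.Quotient.smul_coe, smul_eq_mul]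
          change (((y * g) * x : G) : G ⧸ K.toSubgroup) = ((y * (g * x) : G) : G ⧸ K.toSubgroup)
          rw [mul_assoc] }
    have h := nat r ((1 : G) : G ⧸ K.toSubgroup)
    have hn₁ : (α.hom.app (QV K)).hom.hom ((1 : G) : G ⧸ K.toSubgroup) =
        (n : G ⧸ K.toSubgroup) := hn
    rw [hn₁] at h
    have h' : ev K (((1 : G) * x : G) : G ⧸ K.toSubgroup) = ((n * x : G) : G ⧸ K.toSubgroup) := h
    rw [one_mul] at h'
    exact h'
  -- (3) the key step: `α` fixes the base coset of every `G/K`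
  have key : ∀ K : OpenNormalSubgroup G,
      ev K ((1 : G) : G ⧸ K.toSubgroup) = ((1 : G) : G ⧸ K.toSubgroup) := by
    obtain ⟨K₀, -⟩ := ProfiniteGrp.exist_openNormalSubgroup_sub_open_nhds_of_one
      (isOpen_univ (X := G)) (Set.mem_univ (1 : G))
    haveI : Nonempty (OpenNormalSubgroup G) := ⟨K₀⟩
    let N : OpenNormalSubgroup G → Set G := fun K =>
      {n : G | ev K ((1 : G) : G ⧸ K.toSubgroup) = (n : G ⧸ K.toSubgroup)}
    have hNne : ∀ K, (N K).Nonempty := fun K => by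
      obtain ⟨n, hn⟩ := QuotientGroup.mk_surjective (ev K ((1 : G) : G ⧸ K.toSubgroup))
      exact ⟨n, hn.symm⟩
    have hNclosed : ∀ K, IsClosed (N K) := fun K => by
      obtain ⟨n₀, hn₀⟩ := hNne K
      have : N K = (fun n : G => n₀⁻¹ * n) ⁻¹' (K : Set G) := by
        ext n
        simp only [Set.mem_setOf_eq, Set.mem_preimage, N, SetLike.mem_coe]
        rw [hn₀, QuotientGroup.eq]
        rfl
      rw [this]
      exact K.toOpenSubgroup.isClosed.preimage (by fun_prop)
    have hinf : ∀ (K K' : OpenNormalSubgroup G) (g : G), g ∈ (K ⊓ K').toSubgroup →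
        g ∈ K.toSubgroup ∧ g ∈ K'.toSubgroup := fun K K' g hg => Subgroup.mem_inf.mp hg
    have hdir : Directed (· ⊇ ·) N := fun K K' => by
      refine ⟨K ⊓ K', ?_, ?_⟩
      · intro n hn
        exact mono K (K ⊓ K') (fun g hg => (hinf _ _ g hg).1) n hn
      · intro n hn
        exact mono K' (K ⊓ K') (fun g hg => (hinf _ _ g hg).2) n hn
    obtain ⟨n, hn⟩ := IsCompact.nonempty_iInter_of_directed_nonempty_isCompact_isClosed N hdir
      hNne (fun K => (hNclosed K).isCompact) hNclosed
    have hn' : ∀ K : OpenNormalSubgroup G, n ∈ N K := fun K => Set.mem_iInter.mp hn K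
    -- `n` commutes with every `x` modulo every `K`, hence on the nose
    have hcomm : ∀ x : G, x * n = n * x := by
      intro x
      have hmem : ∀ K : OpenNormalSubgroup G, (n * x)⁻¹ * (x * n) ∈ K.toSubgroup := fun K => by
        have h1 : ev K (x : G ⧸ K.toSubgroup) = ((n * x : G) : G ⧸ K.toSubgroup) :=
          conj K x n (hn' K)
        have h2 : ev K (x : G ⧸ K.toSubgroup) = ((x * n : G) : G ⧸ K.toSubgroup) := by
          have := ev_smul K x ((1 : G) : G ⧸ K.toSubgroup)
          rw [MulAction.Quotient.smul_coe, smul_eq_mul, mul_one, hn' K,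
            MulAction.Quotient.smul_coe, smul_eq_mul] at this
          exact this
        rw [h2] at h1
        exact QuotientGroup.eq.mp h1.symm
      by_contra hne
      have hne' : (n * x)⁻¹ * (x * n) ≠ 1 := by
        intro h
        apply hne
        rw [inv_mul_eq_one] at h
        exact h.symm
      obtain ⟨K₁, hK₁⟩ := ProfiniteGrp.exist_openNormalSubgroup_sub_open_nhds_of_one
        (isOpen_compl_singleton (x := (n * x)⁻¹ * (x * n)))
        (show (1 : G) ∈ ({(n * x)⁻¹ * (x * n)}ᶜ : Set G) from fun h => hne' h.symm)
      exact hK₁ (hmem K₁) rfl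
    have hn1 : n = 1 := by
      have hz : n ∈ Subgroup.center G := Subgroup.mem_center_iff.mpr hcomm
      rw [hZ] at hz
      exact hz
    intro K
    have := hn' K
    rw [hn1] at this
    exact this
  -- (4) conclusion: `α` is the identity on every point of every finite continuous `G`-set
  apply Iso.ext
  apply NatTrans.ext
  funext U
  rw [Iso.refl_hom, NatTrans.id_app]
  apply ObjectProperty.hom_ext
  apply Action.hom_ext
  apply FintypeCat.hom_ext
  intro b
  change (α.hom.app U).hom.hom b = b
  have hb : IsOpen (MulAction.stabilizer G b : Set G) :=
    (bCat_isContinuous_iff U.obj).mp U.property b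
  obtain ⟨K, hK⟩ := ProfiniteGrp.exist_openNormalSubgroup_sub_open_nhds_of_one hb
    (MulAction.stabilizer G b).one_mem
  have hKb : K.toSubgroup ≤ MulAction.stabilizer G b := fun g hg => hK hg
  -- the orbit map `G/K → U`, `gK ↦ g • b`
  let φ : QV K ⟶ U := ObjectProperty.homMk
    { hom := FintypeCat.homMk fun q : G ⧸ K.toSubgroup =>
        Quotient.liftOn' q (fun g : G => g • b) fun g g' h => by
          have h' : g⁻¹ * g' ∈ K.toSubgroup := QuotientGroup.leftRel_apply.mp h
          have := hKb h'
          rw [MulAction.mem_stabilizer_iff, mul_smul, inv_smul_eq_iff] at this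
          exact this.symm
      comm := fun x => by
        apply FintypeCat.hom_ext
        intro q
        obtain ⟨g, rfl⟩ := QuotientGroup.mk_surjective (q : G ⧸ K.toSubgroup)
        simp only [FintypeCat.comp_apply, FintypeCat.homMk_apply]
        change Quotient.liftOn' (x • (g : G ⧸ K.toSubgroup) : G ⧸ K.toSubgroup) _ _ =
          x • (g • b)
        rw [MulAction.Quotient.smul_coe, smul_eq_mul]
        exact mul_smul x g b }
  have h := nat φ ((1 : G) : G ⧸ K.toSubgroup)
  change (α.hom.app U).hom.hom ((1 : G) • b) = Quotient.liftOn' (ev K _) _ _ at h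
  rw [key K, one_smul] at h
  rw [h]
  exact one_smul G b

/-- **`B(G)` is id-rigid IFF `G` is centre-free**, for a profinite group `G` (centre variant of
[SemiAnbd] §0 "`B(G)` slim iff `G` slim"). [cite: MochizukiSemiAnbd2006, Section 0 p.6] -/
theorem isIdRigid_bCat_iff_center_eq_bot : IsIdRigid (BCat G) ↔ Subgroup.center G = ⊥ :=
  ⟨center_eq_bot_of_isIdRigid_bCat, isIdRigid_bCat_of_center_eq_bot⟩

end CenterFree

namespace AbsTopIII

variable {G : Type} [Group G] [TopologicalSpace G] [IsTopologicalGroup G] [CompactSpace G]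
  [TotallyDisconnectedSpace G]

/-- **[AbsTopIII] Cor. 4.5 (v) at the Galois-category instance `EA = B(Π)` IFF `Π` is centre-free**
(`T = TF`): the exact group-theoretic content of item (v) at abc-iut-L4-t10's instance — weaker than
the slimness (Lemma 4.3) print routes it through. [cite: MochizukiAbsTopIII2015, Corollary 4.5 (v) p.109] -/
theorem cor_4_5_v_arch_ofGaloisCategory_iff_center_eq_bot :
    Literature.AnabelianGeometry.AbsoluteAnabelian.AbsTopIII.Cor_4_5_v
        (archLogFrobeniusData (AutHolFieldFunctor.ofGaloisCategory G)) ↔ Subgroup.center G = ⊥ :=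
  cor_4_5_v_arch_ofGaloisCategory_iff.trans isIdRigid_bCat_iff_center_eq_bot

/-- The same at the `TM` model. [cite: MochizukiAbsTopIII2015, Corollary 4.5 (v) p.109] -/
theorem cor_4_5_v_arch_TM_ofGaloisCategory_iff_center_eq_bot :
    Literature.AnabelianGeometry.AbsoluteAnabelian.AbsTopIII.Cor_4_5_v
        (archLogFrobeniusDataTM (AutHolFieldFunctor.ofGaloisCategory G)) ↔ Subgroup.center G = ⊥ :=
  cor_4_5_v_arch_TM_ofGaloisCategory_iff.trans isIdRigid_bCat_iff_center_eq_bot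

/-- **Cor. 4.5 (v) at `B(Π)` for every CENTRE-FREE profinite `Π`** (no slimness needed).
[cite: MochizukiAbsTopIII2015, Corollary 4.5 (v) p.109] -/
theorem cor_4_5_v_arch_ofGaloisCategory_of_center_eq_bot (hZ : Subgroup.center G = ⊥) :
    Literature.AnabelianGeometry.AbsoluteAnabelian.AbsTopIII.Cor_4_5_v
      (archLogFrobeniusData (AutHolFieldFunctor.ofGaloisCategory G)) :=
  cor_4_5_v_arch_ofGaloisCategory_iff_center_eq_bot.2 hZ

end AbsTopIII

/-! ### Rider: the WHOLE of Cor 4.5 (i)–(v) at the Galois-category instance IFF `Π` is centre-free -/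

namespace AbsTopIII

open Literature.AnabelianGeometry.Anabelioids (Induction.quotObj)

variable {G : Type} [Group G] [TopologicalSpace G] [IsTopologicalGroup G] [CompactSpace G]
  [TotallyDisconnectedSpace G]

/-- **[AbsTopIII] Cor. 4.5 (i)–(v) AS TYPED, at the Galois-category instance `EA = B(Π)` (`T = TF`),
IFF `Π` is centre-free.**  (⇐): abc-iut-L4-t10's `cor_4_5_arch` fed with the object `Π/Π` of `B(Π)` and
the id-rigidity of `B(Π)` from `Z(Π) = 1` (`isIdRigid_bCat_of_center_eq_bot`); (⇒): item (v) alone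
forces `Z(Π) = 1`.  So at this instance the printed input "slim" (Lemma 4.3) may be replaced by
"centre-free", and nothing less will do. [cite: MochizukiAbsTopIII2015, Corollary 4.5 pp.107–109] -/
theorem cor_4_5_arch_ofGaloisCategory_iff_center_eq_bot :
    Literature.AnabelianGeometry.AbsoluteAnabelian.AbsTopIII.Cor_4_5
        (archLogFrobeniusData (AutHolFieldFunctor.ofGaloisCategory G))
        (archTelecoreData (AutHolFieldFunctor.ofGaloisCategory G)) ↔ Subgroup.center G = ⊥ := by
  refine ⟨fun h => center_eq_bot_of_cor_4_5_v_arch_ofGaloisCategory ((cor_4_5_iff _ _).mp h).2.2.2.2,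
    fun hZ => ?_⟩
  haveI : Subsingleton (G ⧸ (⊤ : Subgroup G)) := QuotientGroup.subsingleton_quotient_top
  haveI : Finite (G ⧸ (⊤ : Subgroup G)) := Finite.of_subsingleton
  exact cor_4_5_arch (AutHolFieldFunctor.ofGaloisCategory G)
    (AutHolFieldFunctor.objOfBCat G (Induction.quotObj (⊤ : Subgroup G) isOpen_univ))
    (AutHolFieldFunctor.isIdRigid_EA_ofConstField
      (isIdRigid_uLiftHom (isIdRigid_bCat_of_center_eq_bot hZ)))

/-- The same for the `TM` model (abc-iut-w5-d226's `cor_4_5_arch_TM`).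
[cite: MochizukiAbsTopIII2015, Corollary 4.5 pp.107–109] -/
theorem cor_4_5_arch_TM_ofGaloisCategory_iff_center_eq_bot :
    Literature.AnabelianGeometry.AbsoluteAnabelian.AbsTopIII.Cor_4_5
        (archLogFrobeniusDataTM (AutHolFieldFunctor.ofGaloisCategory G))
        (archTelecoreDataTM (AutHolFieldFunctor.ofGaloisCategory G)) ↔ Subgroup.center G = ⊥ := by
  refine ⟨fun h => ?_, fun hZ => ?_⟩
  · exact center_eq_bot_of_isIdRigid_bCat
      (cor_4_5_v_arch_TM_ofGaloisCategory_iff.1 ((cor_4_5_iff _ _).mp h).2.2.2.2)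
  · haveI : Subsingleton (G ⧸ (⊤ : Subgroup G)) := QuotientGroup.subsingleton_quotient_top
    haveI : Finite (G ⧸ (⊤ : Subgroup G)) := Finite.of_subsingleton
    exact cor_4_5_arch_TM (AutHolFieldFunctor.ofGaloisCategory G)
      (AutHolFieldFunctor.objOfBCat G (Induction.quotObj (⊤ : Subgroup G) isOpen_univ))
      (AutHolFieldFunctor.isIdRigid_EA_ofConstField
        (isIdRigid_uLiftHom (isIdRigid_bCat_of_center_eq_bot hZ)))

/-- **Cor. 4.5 (i)–(v) at `B(Π)` for every centre-free profinite `Π`** (e.g. every slim `Π`, every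
non-abelian free profinite group, `G_{ℚ_p}`), from `Z(Π) = 1` alone.
[cite: MochizukiAbsTopIII2015, Corollary 4.5 pp.107–109] -/
theorem cor_4_5_arch_ofGaloisCategory_of_center_eq_bot (hZ : Subgroup.center G = ⊥) :
    Literature.AnabelianGeometry.AbsoluteAnabelian.AbsTopIII.Cor_4_5
        (archLogFrobeniusData (AutHolFieldFunctor.ofGaloisCategory G))
        (archTelecoreData (AutHolFieldFunctor.ofGaloisCategory G)) :=
  cor_4_5_arch_ofGaloisCategory_iff_center_eq_bot.2 hZ

end AbsTopIII

end Literature.AnabelianGeometry.AbsoluteAnabelian
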